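import Literature.AnabelianGeometry.AbsoluteAnabelian.AbsTopIThm26iProofs
import Literature.AnabelianGeometry.AbsoluteAnabelian.MLFGaloisElasticProofs
import Literature.AnabelianGeometry.AbsoluteAnabelian.MLFGaloisGroupsHolds
import Literature.AnabelianGeometry.AbsoluteAnabelian.FiniteFieldAbsoluteGaloisFreeProcyclic
import HarnessLib

/-!
# [AbsTopI] Thm 2.6 (i), (ii), (iv) AS TYPED: the universal closures of the predicates
# `Thm26i`, `Thm26ii`, `Thm26iv` are REFUTED; point-extension instance forms — PROOF-ONLY

S. Mochizuki, *Topics in Absolute Anabelian Geometry I: Generalities*, J. Math. Sci. Univ. Tokyo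
**19** (2012) [AbsTopI], Thm 2.6 (i) p. 21, (ii) p. 21, (iv) p. 22 (manuscript pagination, lit key
`paper:url-11ac98ba15fc`) [cite: MochizukiAbsTopI2012, Thm 2.6 pp.21-22].

abc-iut cell, block F fact-proving wave, seat abc-iut-f-090 (gen 0; doc repair gen 4, referee lane L4
DEFECT L12-n28: the two print quotations below re-cut to the verbatim text of p. 21).

The statement file `AbsTopISemiAbsolute.lean` (abc-iut-L4-t4) types the three items as PREDICATES
`FundamentalExtension.Thm26i`, `Thm26ii B Σ`, `Thm26iv Σ` on an ABSTRACT extension of profinite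
groups `1 → Δ → Π → G → 1` (`FundamentalExtension`): the printed hypotheses of Thm 2.6 (p. 21:
"an extension which is either of AFG-type or of GSAFG-type; `(k, X, Σ)` partial construction data
[...] for `Π ↠ G`. Suppose further that `k` is either an FF, an MLF, or an NF, and that every
prime `∈ Σ` is invertible in `k`"; AFG/GSAFG-type as in Def 2.1) are not part of the
predicate — the typed items carry only the base datum (FF: `G ≅ Ẑ`; MLF: `MLFBase`).  They are
the FACT-LIST rows F-0246, F-0247, F-0248 of the abc-iut cell (kernel_closedness = parametrised).  This proof-only companion records the kernel events that
classify them: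

* **universal closures REFUTED** (`not_forall_thm26i`, `not_forall_thm26ii`,
  `not_forall_thm26iv`, and the sharper `not_forall_mlfBase_thm26iv`) by explicit witnesses with
  GENUINE base-field data: for (i) the point extension `Π = G = G_{ℚ₂}` (indeed ANY extension with
  MLF base data, next bullet); for (ii) and (iv) the extension `Π := G_{ℚ₂} × G_{ℚ₂} ↠ G := G_{ℚ₂}`
  (first projection; `Δ = 1 × G_{ℚ₂}`, MLF base `K = ℚ₂`, `Σ = ∅`), which violates (ii) ["`δ¹_l(Π)
  − δ¹_l(G) = 0` for `l ∉ Σ`": at `l = 3`, `δ¹₃(Π) ≥ 2 > 1 = δ¹₃(G)`] and (iv) ["if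
  `Σ ≠ Primes`, `Δ` is almost pro-omissive": `Δ ≅ G_{ℚ₂}` is not, by the tree's
  `not_isAlmostProOmissive_of_isOpen_absoluteGaloisGroup`].  The ranks come from the LANDED rank
  formula `thm26_ii_delta_gal_holds` (`δ¹_l(G_k) = 1` for `l ≠ p`, `δ¹_p(G_k) = [k : ℚ_p] + 1`)
  through `exists_surjective_padicInt_of_one_le_freeProlRank` and the elementary
  `two_le_freeProlRank_prod_of_surjective` (`G ↠ ℤ_l` gives `G × G ↠ ℤ_l²`).
* **(i) distinguishes the field type**: `MLFBase.not_thm26i` — for EVERY extension with MLF base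
  data `G ≅ G_k`, the typed (i) FAILS (`δ¹_p(Π) ≥ δ¹_p(G) = [k : ℚ_p] + 1 ≥ 2`), in accordance with
  the theme of Thm 2.6 (its printed title, p. 21: "Field Types and Group-theoreticity").
* **instance forms PROVED at the point extensions** (`Π = G`, `Δ = 1`, i.e. `X = Spec k`):
  `thm26i_of_geom_eq_bot_of_isFreeProcyclic` (any `E` with `Δ = 1` and `G ≅ Ẑ`) and
  `exists_thm26i_absoluteGaloisGroup_finite` (`Π = G = Gal(k̄/k)`, `k` a finite field, free
  procyclic by the tree's `isFreeProcyclic_absoluteGaloisGroup_of_finite`);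
  `MLFBase.thm26iv_of_geom_eq_bot` (any `E` with MLF base and `Δ = 1`, every `Σ`);
  `MLFBase.thm26ii_of_geom_eq_bot` (any `E` with MLF base and `Δ = 1`, every `Σ`, GIVEN the
  topological finite generation of `Π = G ≅ G_k` — [NSW] Thm 7.5.10, the one input of (ii) that is
  not a Literature theorem; it is abc-iut GAP-LEDGER row G-L4t4-2, proved Summits-side).

The general instance forms remain the landed CONDITIONAL discharges from the printed inputs
(`thm26i_of_isFreeProcyclic`, `thm26ii_of_clauses` / `thm26ii_of_starCondition(_of_isProSet)`,
`MLFBase.thm26iv`).  HONEST FRAMING: a refuted universal closure says the row is a HYPOTHESIS ON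
DATA, not that anything in print is false; no statement of [AbsTopI] is strengthened or disputed;
nothing here bears on [IUTchIII] Cor. 3.12; typed ≠ proved.  Theorems only (no `def`, no named
fact); axioms standard.
-/

noncomputable section

open Topology Field

namespace Literature.AnabelianGeometry.AbsoluteAnabelian

universe u

/-! ### Two elementary rank facts -/

section Rank

variable {G : Type u} [Group G] [TopologicalSpace G]

/-- If `G` surjects continuously onto `ℤ_l`, then `G × G` surjects continuously onto `ℤ_l²`, so
`2 ≤ δ¹_l(G × G)` (`δ¹_l = freeProlRank`). [cite: MochizukiAbsTopI2012, Thm 2.6 p.21] -/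
theorem two_le_freeProlRank_prod_of_surjective (l : ℕ) [Fact l.Prime]
    (f : G →ₜ* Multiplicative ℤ_[l]) (hf : Function.Surjective f) :
    (2 : ℕ∞) ≤ freeProlRank (G × G) l := by
  -- the coordinate selections `G × G → G`
  have hsel : ∀ i : Fin 2, Continuous fun x : G × G => if i = 0 then x.1 else x.2 := by
    intro i
    by_cases hi : i = 0
    · simp only [hi, if_true]
      exact continuous_fst
    · simp only [hi, if_false]
      exact continuous_snd
  -- the character `(x, y) ↦ (f x, f y)` with values in `ℤ_l^{Fin 2}`
  let φ : G × G →ₜ* Multiplicative (Fin 2 → ℤ_[l]) :=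
    { toFun := fun x => Multiplicative.ofAdd
        (fun i : Fin 2 => Multiplicative.toAdd (f (if i = 0 then x.1 else x.2)))
      map_one' := by
        change Multiplicative.ofAdd _ = Multiplicative.ofAdd 0
        congr 1
        funext i
        by_cases hi : i = 0 <;> simp [hi]
      map_mul' := fun x y => by
        rw [← ofAdd_add]
        congr 1
        funext i
        by_cases hi : i = 0 <;> simp [hi, map_mul]
      continuous_toFun := continuous_ofAdd.comp (continuous_pi fun i =>
        continuous_toAdd.comp ((map_continuous f).comp (hsel i))) }
  have hφ : Function.Surjective φ := by
    intro y
    obtain ⟨a, ha⟩ := hf (Multiplicative.ofAdd (Multiplicative.toAdd y 0))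
    obtain ⟨b, hb⟩ := hf (Multiplicative.ofAdd (Multiplicative.toAdd y 1))
    refine ⟨(a, b), ?_⟩
    change Multiplicative.ofAdd _ = y
    rw [← ofAdd_toAdd y]
    congr 1
    funext i
    fin_cases i
    · simp [ha]
    · simp [hb]
  exact_mod_cast le_freeProlRank_of_surjective l φ hφ

/-- `δ¹_l` of the open subgroup `⊤ ⊆ G` is `δ¹_l(G)` (`⊤ ≃ₜ* G`).
[cite: MochizukiAbsTopI2012, Thm 2.6 p.21] -/
theorem freeProlRank_top (l : ℕ) [Fact l.Prime] :
    freeProlRank (⊤ : Subgroup G) l = freeProlRank G l :=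
  freeProlRank_eq_of_continuousMulEquiv
    ({ Subgroup.topEquiv with
        continuous_toFun := continuous_subtype_val
        continuous_invFun := Continuous.subtype_mk continuous_id _ } :
      (⊤ : Subgroup G) ≃ₜ* G) l

end Rank

/-! ### Trivial groups: topologically finitely generated, almost pro-omissive -/

section Trivial

variable {D : Type u} [Group D] [TopologicalSpace D] [Subsingleton D]

/-- A trivial group is pro-`Σ` for every `Σ` (all indices are `1`).
[cite: MochizukiAbsTopI2012, Def 1.1 (iii) p.10] -/
theorem isProSet_of_subsingleton (S : Set ℕ) : IsProSet D S := by
  refine ⟨fun U _ _ q hq hdvd => ?_⟩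
  rw [Subsingleton.elim U ⊤, Subgroup.index_top, Nat.dvd_one] at hdvd
  exact absurd hdvd hq.one_lt.ne'

/-- A trivial group is almost pro-omissive (it is pro-`(≠ 2)` itself).
[cite: MochizukiAbsTopI2012, Def 1.1 (iii) p.10] -/
theorem isAlmostProOmissive_of_subsingleton : IsAlmostProOmissive D := by
  refine ⟨⟨2, ⊤, Nat.prime_two, ?_, isProSet_of_subsingleton _⟩⟩
  rw [Subgroup.coe_top]
  exact isOpen_univ

/-- A trivial group is topologically finitely generated (by `∅`).
[cite: MochizukiAbsTopI2012, §0 p.8] -/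
theorem isTopologicallyFinitelyGenerated_of_subsingleton [IsTopologicalGroup D] :
    IsTopologicallyFinitelyGenerated D :=
  ⟨⟨∅, Subsingleton.elim _ _⟩⟩

end Trivial

namespace FundamentalExtension

/-! ### (i) fails for EVERY extension with MLF base data -/

/-- **[AbsTopI] Thm 2.6 (i) AS TYPED is an FF-statement: it FAILS for every extension with MLF
base data.**  If `G ≅ G_k`, `k/ℚ_p` finite, then for the open subgroup `H = Π` itself
`δ¹_p(Π) ≥ δ¹_p(G) = [k : ℚ_p] + 1 ≥ 2` (rank formula `thm26_ii_delta_gal_holds`; `δ¹` does not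
increase along `Π ↠ G`), contradicting the clause "`δ¹_l(H) = 1` for every open `H` and every `l`"
of the typed (i).  (Thm 2.6: the field type FF / MLF / NF is group-theoretic.)
[cite: MochizukiAbsTopI2012, Thm 2.6 (i)-(ii) p.21] -/
theorem MLFBase.not_thm26i {E : FundamentalExtension.{0}} (B : E.MLFBase) : ¬ E.Thm26i := by
  rintro ⟨-, -, h3⟩
  letI := B.instPrime
  have htop : IsOpen (((⊤ : Subgroup E.arith)) : Set E.arith) := by
    rw [Subgroup.coe_top]
    exact isOpen_univ
  have h1 : @freeProlRank (⊤ : Subgroup E.arith) _ _ B.p B.instPrime = 1 := h3 ⊤ htop B.p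
  rw [freeProlRank_top] at h1
  have h2 : @freeProlRank E.gal _ _ B.p B.instPrime ≤ @freeProlRank E.arith _ _ B.p B.instPrime :=
    freeProlRank_le_of_surjective E.aug E.aug_surjective B.p
  rw [(freeProlRank_gal B).2, h1] at h2
  have h3' : Module.finrank ℚ_[B.p] B.K + 1 ≤ 1 := by exact_mod_cast h2
  have hpos : 0 < Module.finrank ℚ_[B.p] B.K := Module.finrank_pos
  omega

/-! ### The witness `G_{ℚ₂} × G_{ℚ₂} ↠ G_{ℚ₂}` and the refuted universal closures -/

/-- **F-0246: the universal closure of the typed [AbsTopI] Thm 2.6 (i) is FALSE** — witness: any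
extension with MLF base data, e.g. the point extension `Π = G = G_{ℚ₂}` (`MLFBase.not_thm26i`).
The row is a predicate on data (an FF-type hypothesis), admissible at named instances only.
[cite: MochizukiAbsTopI2012, Thm 2.6 (i) p.21] -/
theorem not_forall_thm26i :
    ¬ ∀ E : FundamentalExtension.{0},
      Literature.AnabelianGeometry.AbsoluteAnabelian.FundamentalExtension.Thm26i E := by
  intro h
  let E : FundamentalExtension.{0} :=
    { arith := absoluteGaloisGrp ℚ_[2], gal := absoluteGaloisGrp ℚ_[2],
      aug := ContinuousMonoidHom.id _, aug_surjective := Function.surjective_id }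
  let B : E.MLFBase := { p := 2, K := ℚ_[2], galIso := ContinuousMulEquiv.refl _ }
  exact B.not_thm26i (h E)

/-- The witness extension's `Δ`-clause: for `Π := G_k × G_k ↠ G := G_k` (first projection) with
`k/ℚ_p` finite, `Δ = Ker = 1 × G_k` is NOT almost pro-omissive (it surjects continuously onto
`G_k`, which is not almost pro-omissive: `not_isAlmostProOmissive_of_isOpen_absoluteGaloisGroup`).
[cite: MochizukiAbsTopI2012, Thm 2.6 (iv) p.22] -/
theorem not_isAlmostProOmissive_ker_fst (p : ℕ) [Fact p.Prime] (K : Type) [Field K]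
    [Algebra ℚ_[p] K] [FiniteDimensional ℚ_[p] K] [CharZero K] :
    ¬ IsAlmostProOmissive
      (ContinuousMonoidHom.fst (absoluteGaloisGroup K)
        (absoluteGaloisGroup K)).toMonoidHom.ker := by
  set Γ := absoluteGaloisGroup K
  set N := (ContinuousMonoidHom.fst Γ Γ).toMonoidHom.ker with hN
  intro h
  -- `N` is closed in the compact `Γ × Γ`, hence compact
  have hNc : IsClosed (N : Set (Γ × Γ)) := by
    have : (N : Set (Γ × Γ)) = Prod.fst ⁻¹' {1} := by
      ext x
      simp [hN, MonoidHom.mem_ker]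
    rw [this]
    exact isClosed_singleton.preimage continuous_fst
  haveI : CompactSpace N := isCompact_iff_compactSpace.mp hNc.isCompact
  -- the continuous surjection `N ↠ ⊤ ⊆ Γ`, `(1, y) ↦ y`
  let ψ : N →ₜ* (⊤ : Subgroup Γ) :=
    { toFun := fun x => ⟨(x : Γ × Γ).2, Subgroup.mem_top _⟩
      map_one' := rfl
      map_mul' := fun _ _ => rfl
      continuous_toFun :=
        Continuous.subtype_mk (continuous_snd.comp continuous_subtype_val) _ }
  have hψ : Function.Surjective ψ := by
    rintro ⟨y, -⟩
    refine ⟨⟨(1, y), ?_⟩, rfl⟩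
    simp [hN, MonoidHom.mem_ker]
  have htop : IsOpen (((⊤ : Subgroup Γ)) : Set Γ) := by
    rw [Subgroup.coe_top]
    exact isOpen_univ
  exact not_isAlmostProOmissive_of_isOpen_absoluteGaloisGroup p K ⊤ htop (h.of_surjective ψ hψ)

/-- **F-0247: the universal closure of the typed [AbsTopI] Thm 2.6 (ii) is FALSE** — witness:
`Π := G_{ℚ₂} × G_{ℚ₂} ↠ G := G_{ℚ₂}` (first projection) with MLF base `k = ℚ₂` and `Σ = ∅` (any
`Σ ∌ 3` works): the clause "`δ¹_l(Π) − δ¹_l(G) = 0` if `l ∉ Σ`" fails at `l = 3`, since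
`δ¹₃(G_{ℚ₂}) = 1` (rank formula) while `δ¹₃(Π) ≥ 2` (`G_{ℚ₂} ↠ ℤ₃` twice).  The row is a predicate
on data (a hypothesis "`Π` arises from geometry"), admissible at named instances only.
[cite: MochizukiAbsTopI2012, Thm 2.6 (ii) p.21] -/
theorem not_forall_thm26ii :
    ¬ ∀ (E : FundamentalExtension.{0}) (B : E.MLFBase) (S : Set ℕ),
      Literature.AnabelianGeometry.AbsoluteAnabelian.FundamentalExtension.Thm26ii E B S := by
  intro h
  let Γ := absoluteGaloisGroup ℚ_[2]
  let E : FundamentalExtension.{0} :=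
    { arith := ProfiniteGrp.of (Γ × Γ), gal := absoluteGaloisGrp ℚ_[2],
      aug := ContinuousMonoidHom.fst Γ Γ, aug_surjective := Prod.fst_surjective }
  let B : E.MLFBase := { p := 2, K := ℚ_[2], galIso := ContinuousMulEquiv.refl _ }
  obtain ⟨-, -, -, hoff, -, -⟩ := h E B ∅
  -- `δ¹₃(G) = 1`
  have hG : freeProlRank E.gal 3 = 1 := (freeProlRank_gal B).1 3 (by decide)
  -- `δ¹₃(Π) ≥ 2`
  obtain ⟨f, hf⟩ := exists_surjective_padicInt_of_one_le_freeProlRank (G := E.gal) 3 hG.symm.le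
  have hPi : (2 : ℕ∞) ≤ freeProlRank E.arith 3 := two_le_freeProlRank_prod_of_surjective 3 f hf
  -- the clause at `l = 3 ∉ ∅`
  have h3 : freeProlRank E.arith 3 = freeProlRank E.gal 3 := hoff 3 (Set.notMem_empty 3)
  rw [h3, hG] at hPi
  exact absurd hPi (by decide)

/-- **F-0248 (sharper form): even among extensions WITH MLF base data, the universal closure of
the typed [AbsTopI] Thm 2.6 (iv) is FALSE** — witness: `Π := G_{ℚ₂} × G_{ℚ₂} ↠ G := G_{ℚ₂}`, `Σ = ∅
≠ Primes`: the clause "`Δ` is almost pro-omissive" fails, `Δ ≅ G_{ℚ₂}`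
(`not_isAlmostProOmissive_ker_fst`).  (The FIRST clause of (iv) holds for every extension with MLF
base data: `le_geom_of_isAlmostProOmissive_of_isElastic_gal` with `MLFBase.isElastic_gal`; what
fails is the construction-data input "`Δ` is pro-`Σ`, topologically finitely generated".)
[cite: MochizukiAbsTopI2012, Thm 2.6 (iv) p.22] -/
theorem not_forall_mlfBase_thm26iv :
    ¬ ∀ (E : FundamentalExtension.{0}) (_ : E.MLFBase) (S : Set ℕ),
      Literature.AnabelianGeometry.AbsoluteAnabelian.FundamentalExtension.Thm26iv E S := by
  intro h
  let Γ := absoluteGaloisGroup ℚ_[2]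
  let E : FundamentalExtension.{0} :=
    { arith := ProfiniteGrp.of (Γ × Γ), gal := absoluteGaloisGrp ℚ_[2],
      aug := ContinuousMonoidHom.fst Γ Γ, aug_surjective := Prod.fst_surjective }
  let B : E.MLFBase := { p := 2, K := ℚ_[2], galIso := ContinuousMulEquiv.refl _ }
  have hS : (∅ : Set ℕ) ≠ {q | q.Prime} := by
    intro h0
    have : (2 : ℕ) ∈ (∅ : Set ℕ) := by rw [h0]; exact Nat.prime_two
    exact this
  obtain ⟨hapo, -⟩ := (h E B ∅).2 hS
  exact not_isAlmostProOmissive_ker_fst 2 ℚ_[2] hapo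

/-- **F-0248: the universal closure of the typed [AbsTopI] Thm 2.6 (iv) is FALSE** (immediate from
the sharper `not_forall_mlfBase_thm26iv`).  The row is a predicate on data, admissible at named
instances only. [cite: MochizukiAbsTopI2012, Thm 2.6 (iv) p.22] -/
theorem not_forall_thm26iv :
    ¬ ∀ (E : FundamentalExtension.{0}) (S : Set ℕ),
      Literature.AnabelianGeometry.AbsoluteAnabelian.FundamentalExtension.Thm26iv E S :=
  fun h => not_forall_mlfBase_thm26iv fun E _ S => h E S

/-! ### Instance forms at the point extensions (`Δ = 1`) -/

/-- **[AbsTopI] Thm 2.6 (iv) at the point over an MLF**: for EVERY extension with MLF base data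
and `Δ = 1` (`Π = G ≅ G_k`, i.e. `X = Spec k`), the typed (iv) HOLDS for every `Σ`: the first
clause by elasticity of `G_k` (`le_geom_of_isAlmostProOmissive_of_isElastic_gal`,
`MLFBase.isElastic_gal`), the second because the trivial group is almost pro-omissive and
topologically finitely generated. [cite: MochizukiAbsTopI2012, Thm 2.6 (iv) p.22] -/
theorem MLFBase.thm26iv_of_geom_eq_bot {E : FundamentalExtension.{0}} (B : E.MLFBase)
    (hΔ : E.geom = ⊥) (S : Set ℕ) : E.Thm26iv S := by
  refine ⟨fun N hN hNc hNfg hNapo =>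
    le_geom_of_isAlmostProOmissive_of_isElastic_gal B B.isElastic_gal N hN hNc hNfg hNapo,
    fun _ => ?_⟩
  haveI : Subsingleton E.geom := by
    rw [hΔ]
    infer_instance
  exact ⟨isAlmostProOmissive_of_subsingleton, isTopologicallyFinitelyGenerated_of_subsingleton⟩

/-- **[AbsTopI] Thm 2.6 (ii) at the point over an MLF**: for EVERY extension with MLF base data
and `Δ = 1` (`Π = G ≅ G_k`, i.e. `X = Spec k`), the typed (ii) HOLDS for every `Σ`, GIVEN the
topological finite generation of `Π` (= that of `G_k`: [NSW] Thm 7.5.10, the input of the printed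
proof p. 23 "together with that of `G`"; in the tree it is `MLFGaloisTFGProofs` modulo Tate's local
Euler–Poincaré characteristic, discharged Summits-side — abc-iut GAP-LEDGER row G-L4t4-2).  The
`G`-clauses and "`ε¹_p(Π) = ∞`" are theorems (`thm26ii_of_clauses`); `δ¹_l(Π) = δ¹_l(G)` for
every `l` because `Π ↠ G` is a continuous bijection of compact Hausdorff groups, i.e. `Π ≃ₜ* G`.
[cite: MochizukiAbsTopI2012, Thm 2.6 (ii) p.21] -/
theorem MLFBase.thm26ii_of_geom_eq_bot {E : FundamentalExtension.{0}} (B : E.MLFBase)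
    (hΔ : E.geom = ⊥) (htfg : IsTopologicallyFinitelyGenerated E.arith) (S : Set ℕ) :
    E.Thm26ii B S := by
  -- `aug : Π → G` is a continuous bijective homomorphism of compact Hausdorff groups
  have hinj : Function.Injective E.aug := (MonoidHom.ker_eq_bot_iff E.aug.toMonoidHom).mp hΔ
  let e₀ : E.arith ≃ E.gal := Equiv.ofBijective E.aug ⟨hinj, E.aug_surjective⟩
  let eₜ : E.arith ≃ₜ E.gal := Continuous.homeoOfEquivCompactToT2 (f := e₀) (map_continuous E.aug)
  let e : E.arith ≃ₜ* E.gal := ContinuousMulEquiv.mk' eₜ fun x y => map_mul E.aug x y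
  have hrank : ∀ (l : ℕ) [Fact l.Prime], freeProlRank E.arith l = freeProlRank E.gal l :=
    fun l _ => freeProlRank_eq_of_continuousMulEquiv e l
  refine thm26ii_of_clauses B S htfg (fun l _ _ => hrank l) fun l₁ l₂ _ _ _ _ => ?_
  rw [hrank l₁, hrank l₂, tsub_self, tsub_self]

/-- **[AbsTopI] Thm 2.6 (i) at the point over an FF-type base**: for EVERY extension with
`Δ = 1` and `G ≅ Ẑ` free procyclic (`Π = G`), the typed (i) HOLDS — the landed conditional
discharge `thm26i_of_isFreeProcyclic` with its inputs "`Δ` topologically finitely generated"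
(Prop 2.2) and "`T_l(A)/G = 0`" both vacuous for `Δ = 1`.
[cite: MochizukiAbsTopI2012, Thm 2.6 (i) p.21] -/
theorem thm26i_of_geom_eq_bot_of_isFreeProcyclic {E : FundamentalExtension.{u}}
    (hG : IsFreeProcyclic E.gal) (hΔ : E.geom = ⊥) : E.Thm26i := by
  haveI : Subsingleton E.geom := by
    rw [hΔ]
    infer_instance
  refine thm26i_of_isFreeProcyclic (E := E) hG isTopologicallyFinitelyGenerated_of_subsingleton ?_
  intro H _ l _ ψ _ d
  have hd : (d : E.arith) = 1 := by
    rw [← Subgroup.mem_bot, ← hΔ]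
    exact (Subgroup.mem_inf.mp d.2).1
  have : d = 1 := Subtype.ext hd
  rw [this, map_one]

/-- **[AbsTopI] Thm 2.6 (i) at `X = Spec k`, `k` a finite field — a GENUINE instance**: the point
extension `Π = G = Gal(k̄/k)` (`Δ = 1`) satisfies the typed (i), `Gal(k̄/k) ≅ Ẑ` being free
procyclic (tree `isFreeProcyclic_absoluteGaloisGroup_of_finite`, Serre *Local Fields* XIII §2).
[cite: MochizukiAbsTopI2012, Thm 2.6 (i) p.21] -/
theorem exists_thm26i_absoluteGaloisGroup_finite (k : Type u) [Field k] [Finite k] :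
    ∃ E : FundamentalExtension.{u}, Nonempty (E.arith ≃ₜ* absoluteGaloisGroup k) ∧
      E.geom = ⊥ ∧ E.Thm26i := by
  haveI : IsGalois k (AlgebraicClosure k) := IsSepClosure.isGalois
  haveI : CompactSpace (absoluteGaloisGroup k) :=
    inferInstanceAs <| CompactSpace (AlgebraicClosure k ≃ₐ[k] AlgebraicClosure k)
  let E : FundamentalExtension.{u} :=
    { arith := ProfiniteGrp.of (absoluteGaloisGroup k)
      gal := ProfiniteGrp.of (absoluteGaloisGroup k)
      aug := ContinuousMonoidHom.id _
      aug_surjective := Function.surjective_id }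
  have hΔ : E.geom = ⊥ := (MonoidHom.ker_eq_bot_iff _).mpr Function.injective_id
  exact ⟨E, ⟨ContinuousMulEquiv.refl _⟩, hΔ,
    thm26i_of_geom_eq_bot_of_isFreeProcyclic (isFreeProcyclic_absoluteGaloisGroup_of_finite k) hΔ⟩

end FundamentalExtension

end Literature.AnabelianGeometry.AbsoluteAnabelian

end
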